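import Summits.CriticalPhenomena.PercolationContinuityZ3.Theses.PercLowPointHalfSpace
import Summits.CriticalPhenomena.PercolationContinuityZ3.Theorems.BoundaryTwoArmDecay.Negative.LoadBearing
import Summits.CriticalPhenomena.PercolationContinuityZ3.Theorems.PercLowPointHalfSpaceBoundaryTwoArmDecayStubReduction
import Summits.CriticalPhenomena.PercolationContinuityZ3.Theorems.PercLowPointHalfSpaceBoundaryTwoArmDecayStubForest
import Literature.Probability.Percolation.RSW

/-!
# Skeleton of line `merge-forest-level-bridges` for crux `PercLowPointHalfSpace.BoundaryTwoArmDecay`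
# (stmt-CriticalPhenomena-0911) — planner crux-plan, 2026-08-16; lead a1 (prover-line-stmt-CriticalPhenomena-0911-a1-0): stubs 1–2 CLOSED 2026-08-16T15:45Z

Crux (A): `∃ κ C, 0 < κ ∧ ∀ r ≥ 1, P_{p_c(ℤ³)}(E r) ≤ C r^{-(5/2+κ)}`,
`E r = {arm_ℍ(0,r) ∧ arm_ℍ(e,r) ∧ 0 ↮_ℍ e}` (landed `Negative.E`, `Negative.boundaryTwoArmDecay_iff` by `Iff.rfl`),
`ℍ = {z | 0 ≤ z 0}`, `e = Pi.single 1 1`, `f = s(0, e)` the floor edge between the two roots.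

## The line (probabilities at `p = p_c(ℤ³)`; `H_t = {z | t ≤ z 0}`; `h` = bigness threshold, `1 ≤ h ≤ r`)

  `p_c · P(E r) ≤ P(LB♭(r,h)) + P(Thin(r,h) at 0) + P(Thin(r,h) at e)`            STUB `stub_reduction` (M, provable now)
      bridge step `E r = {f closed} ∩ {ω∖f ∈ E r}`, `{f open} ∩ {ω∖f ∈ E r}` has probability `p_c·P(ω∖f ∈ E r)`
      (state of `f` independent of `σ(other edges)`), then the first-exit / last-floor-visit split of each arm:
      either the arm reaches sup-distance `r` inside the slab `{0 ≤ z 0 ≤ h}` (THIN), or its side of the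
      bridge contains a vertex `u ∈ B_r(root)` whose `H_1`-cluster has sup-diameter `≥ h` (♭-witness).
  `c r³ P(LB♭(r,h)) ≤ (M+1) E[D(r,h)] + r³ P(N(r,h) > M)`  (all `M : ℕ`)                 STUB `stub_forest` (L, provable now — THE LEVER)
      vertical+horizontal translation invariance makes the `(r+1)(2r+1)² ≥ r³` root-translates of `LB♭` equiprobable;
      pathwise, a ♭-root `x` at level `t` makes `f_x` a BRIDGE of its `H_t`-cluster `K` with `h`-big `H_{t+1}`-children
      on both sides, so `K` is a branching node of the laminar HEIGHT FOREST of `h`-big clusters `{(t,K)}`;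
      bridges of `K` ≤ `2·#bigchildren(K)·(1 + longest series chain)`, `Σ_branching #children ≤ 2·#leaves`, leaves are
      pairwise vertex-disjoint and each contains an open connected piece of diameter `≥ h/2` inside `ℍ ∩ B_{5r}`:
      `Σ_x 1{LB♭_x} ≤ 4·D·(1+N) ≤ 4(M+1)·D` on `{N ≤ M}`, `≤ #roots ≤ 18 r³` always.  `c = 1/18`.
  `E[D(r,h)] ≤ C (r/h)³ h^{1/4}`                                                         STUB `stub_sparse` (XL, OPEN, HARDEST)
      = SparsePieces / VoidLB(1/4): few pairwise-disjoint macroscopic open pieces per `h`-box at `p_c(ℤ³)`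
      (BK turns it into a polynomial LOWER bound `η(h) ≥ c h^{-1/4}` on a thin-way VOID/blocking probability —
      3-D 'RSW-lite', one-colour, monotone; shared debt with PercNonProliferation.SubpolynomialBlocking (stmt-4446)).
  `P(N(r,h) > r^{1/20}) ≤ C r^{-3}`                                                       STUB `stub_necklace` (L, OPEN)
      NecklaceTail: long SERIES chains of ♭-bridges in one cluster at one level are rare (wall renewal).
  `h ≤ r^{19/20} ⇒ P(Thin(r,h) at a floor root) ≤ C r^{-3}`                               STUB `stub_thinSlab` (XL, OPEN)
      ThinSlabDecay: the slab `{0 ≤ z 0 ≤ h}` at `p_c(ℤ³)` is subcritical with near-linear crossover `ξ_h ≲ h^{20/19-}`.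

`BoundaryTwoArmDecay_of : stub_reduction → stub_forest → stub_sparse → stub_necklace → stub_thinSlab → BoundaryTwoArmDecay`
(PROVED below, exponent bookkeeping with `h = ⌊r^{19/20}⌋₊`, `M = ⌈r^{1/20}⌉₊`:
`P(E r) ≤ C' r^{1/20} h^{-11/4} + C'' r^{-3} = O(r^{-(5/2 + 1/16)})`, `κ = (19/20)(3 - 1/4) - 1/20 - 5/2 = 1/16`).
The general bookkeeping `decay_of_budget` takes the three exponents `(σ, ε, θ)` as parameters
(`κ = θ(3-σ) - ε - 5/2 > 0`), so a lead can re-register the three open stubs at other values in one line each.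

## Disproof used (`Cruxes/BoundaryTwoArmDecay/Disproof.lean` v3; landed `Negative/LoadBearing.lean`, `Negative/OneArmLowerBound.lean`)
`…_false_without_r_ge_one`: every stub carries `1 ≤ r` (or `1 ≤ h ≤ r`). `…_false_without_disjoint`: disjointness is the
BRIDGE — `ω∖f ∉ {0 ↔ e in ℍ}` is a conjunct of `LB♭` and is what makes the two big children DISTINCT in `stub_forest`
(with it dropped `f` is no bridge, `K` need not branch, and the count is void). `…_false_without_second_arm`: BOTH sides must
carry an `h`-big child (`h = r^{19/20}`) — the second ♭-witness of `LB♭`; with one witness only, every floor edge of one big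
cluster would count. `halfSpaceArm_ge` / `quantitativeBGN_exponent_le_two`: no one-arm RATE is used anywhere (the `r³` comes
from translation over LEVELS, not from arm exponents). Targets §(d): none. No stub is an instance of a landed Negative lemma
(both Negative files are imported here and elaborate alongside).
-/

noncomputable section

namespace Summit.CriticalPhenomena.PercolationContinuityZ3.Cruxes.BoundaryTwoArmDecay.MergeForestLevelBridges

open MeasureTheory Filter Topology
open Literature.Probability.Percolation Literature.Probability.LatticeModels
open Summit.CriticalPhenomena.PercolationContinuityZ3.Theorems.BoundaryTwoArmDecay.Negative
  (H e μ E boundaryTwoArmDecay_iff)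
open Summit.CriticalPhenomena.PercolationContinuityZ3.Theses.PercLowPointHalfSpace (BoundaryTwoArmDecay)

/-! ### Objects (readable local vocabulary; the registered stubs below INLINE all of them in tree vocabulary) -/

/-- The upper half-space above level `t`: `H_t = {z | t ≤ z 0}` (`H_0 = ℍ`). -/
abbrev Hge (t : ℤ) : Set (Site 3) := {z : Site 3 | t ≤ z 0}

/-- The floor edge `f_x = {x, x + e}` rooted at `x`. -/
abbrev fl (x : Site 3) : Sym2 (Site 3) := s(x, x + e)

/-- `BigAbove h t u ω`: the open cluster of `u` inside `H_{t+1}` has sup-diameter `≥ h`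
(two of its vertices `v, w` differ by `≥ h` in some coordinate). -/
def BigAbove (h : ℕ) (t : ℤ) (u : Site 3) (ω : BondConfig (Site 3)) : Prop :=
  ∃ v w : Site 3, ω ∈ openConnIn (Hge (t + 1)) u v ∧ ω ∈ openConnIn (Hge (t + 1)) u w ∧
    ∃ i : Fin 3, (h : ℤ) ≤ |v i - w i|

/-- `LB♭(r,h)` at root `x` (level `t = x 0`): the floor edge `f_x` is OPEN, it is a BRIDGE of the `H_t`-cluster of `x`
(`x ↮ x+e` in `H_t` once `f_x` is removed), and each side of the bridge contains, within `B_r` of its root, a vertex whose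
`H_{t+1}`-cluster is `h`-big.  (No `r`-arms: the line only uses `h`-bigness of the two sides.) -/
def LBflatAt (r h : ℕ) (x : Site 3) : Set (BondConfig (Site 3)) :=
  {ω | fl x ∈ ω ∧ ω \ {fl x} ∉ openConnIn (Hge (x 0)) x (x + e) ∧
    (∃ u : Site 3, u - x ∈ box 3 r ∧ ω \ {fl x} ∈ openConnIn (Hge (x 0)) x u ∧ BigAbove h (x 0) u ω) ∧
    (∃ u : Site 3, u - (x + e) ∈ box 3 r ∧ ω \ {fl x} ∈ openConnIn (Hge (x 0)) (x + e) u ∧ BigAbove h (x 0) u ω)}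

/-- `Thin(r,h)` at a FLOOR root `x` (`x 0 = 0`): `x` is joined to sup-distance `≥ r` inside the slab
`{0 ≤ z 0 ≤ h}`. -/
def ThinFloor (r h : ℕ) (x : Site 3) : Set (BondConfig (Site 3)) :=
  {ω | ∃ y : Site 3, (∃ i : Fin 3, (r : ℤ) ≤ |y i - x i|) ∧
    ω ∈ openConnIn {z : Site 3 | 0 ≤ z 0 ∧ z 0 ≤ h} x y}

/-- `D(r,h)(ω)`: the maximal number of pairwise vertex-DISJOINT `ω`-open connected vertex sets inside `ℍ ∩ B_{5r}`,
each of sup-diameter `≥ h/2` (the packing number of macroscopic pieces; bounded by `|B_{5r}|`, so `sSup` is a max). -/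
def Dpieces (r h : ℕ) (ω : BondConfig (Site 3)) : ℕ :=
  sSup {k : ℕ | ∃ S : Fin k → Finset (Site 3),
    (∀ a, (↑(S a) : Set (Site 3)) ⊆ {z : Site 3 | 0 ≤ z 0} ∩ ↑(box 3 (5 * r))) ∧
    (∀ a, ∀ u ∈ S a, ∀ v ∈ S a, ω ∈ openConnIn (↑(S a) : Set (Site 3)) u v) ∧
    (∀ a, ∃ u ∈ S a, ∃ v ∈ S a, ∃ i : Fin 3, (h : ℤ) ≤ 2 * |u i - v i|) ∧
    (∀ a b, a ≠ b → Disjoint (S a) (S b))}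

/-- `N(r,h)(ω)`: the longest SERIES CHAIN of ♭-bridges — the maximal number of distinct ♭-roots `x` at a common level
`t ∈ [0,r]` in `B_r` whose floor edges are all pivotal for ONE connection `u ↔ v` inside `H_t` (i.e. lie on a common path
of the bridge tree of one `H_t`-cluster).  Bounded by `|B_r|`. -/
def Nchain (r h : ℕ) (ω : BondConfig (Site 3)) : ℕ :=
  sSup {m : ℕ | ∃ t : ℤ, ∃ u v : Site 3, ∃ x : Fin m → Site 3, Function.Injective x ∧ 0 ≤ t ∧
    ∀ a, x a 0 = t ∧ x a ∈ box 3 r ∧ ω ∈ LBflatAt r h (x a) ∧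
      ω ∈ openConnIn (Hge t) u v ∧ ω \ {fl (x a)} ∉ openConnIn (Hge t) u v}

/-! ### The five statements (named `Prop`s, parametrised by the three exponents) -/

/-- STUB 1 statement (REDUCTION, provable now). -/
def Reduction : Prop :=
  ∀ r h : ℕ, 1 ≤ r →
    (criticalProbI 3 : ℝ) * μ.real (E r) ≤
      μ.real (LBflatAt r h 0) + μ.real (ThinFloor r h 0) + μ.real (ThinFloor r h e)

/-- STUB 2 statement (FOREST INEQUALITY, provable now; the lever). -/
def Forest : Prop :=
  ∃ c : ℝ, 0 < c ∧ ∀ r h M : ℕ, 1 ≤ r → 1 ≤ h → h ≤ r →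
    c * (r : ℝ) ^ 3 * μ.real (LBflatAt r h 0) ≤
      (M + 1 : ℝ) * (∫ ω, (Dpieces r h ω : ℝ) ∂μ) + (r : ℝ) ^ 3 * μ.real {ω | M < Nchain r h ω}

/-- STUB 3 statement (SPARSE PIECES with per-box growth exponent `σ`; open, hardest). -/
def Sparse (σ : ℝ) : Prop :=
  ∃ C : ℝ, ∀ r h : ℕ, 1 ≤ h → h ≤ r →
    ∫ ω, (Dpieces r h ω : ℝ) ∂μ ≤ C * ((r : ℝ) / h) ^ 3 * (h : ℝ) ^ σ

/-- STUB 4 statement (NECKLACE TAIL at threshold `r^ε`; open). -/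
def Necklace (ε : ℝ) : Prop :=
  ∃ C : ℝ, ∀ r h : ℕ, 1 ≤ h → h ≤ r →
    μ.real {ω | (r : ℝ) ^ ε < (Nchain r h ω : ℝ)} ≤ C * (r : ℝ) ^ (-3 : ℝ)

/-- STUB 5 statement (THIN-SLAB DECAY for slab thickness `h ≤ r^θ`; open). -/
def ThinSlab (θ : ℝ) : Prop :=
  ∃ C : ℝ, ∀ r h : ℕ, 1 ≤ r → (h : ℝ) ≤ (r : ℝ) ^ θ → ∀ x : Site 3, x 0 = 0 →
    μ.real (ThinFloor r h x) ≤ C * (r : ℝ) ^ (-3 : ℝ)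

/-! ### Registered stubs (the ONLY `sorry`s of this file; signatures fully inlined in tree vocabulary) -/

/-- STUB 1 (M) — CLOSED (landed p98370, `Theorems.BoundaryTwoArmDecay.stub_reduction`) — bridge identity + first-exit/last-floor-visit split:
`p_c · P(E r) ≤ P(LB♭(r,h) at 0) + P(Thin(r,h) at 0) + P(Thin(r,h) at e)`. -/
theorem stub_reduction :
    ∀ r h : ℕ, 1 ≤ r →
      (criticalProbI 3 : ℝ) *
          (bondPercolation (zdGraph 3) (criticalProbI 3)).real
            {ω | (∃ y : Site 3, (∃ i : Fin 3, (r : ℤ) ≤ |y i|) ∧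
                  ω ∈ openConnIn {x : Site 3 | 0 ≤ x 0} 0 y) ∧
                (∃ y : Site 3, (∃ i : Fin 3, (r : ℤ) ≤ |y i - (Pi.single 1 1 : Site 3) i|) ∧
                  ω ∈ openConnIn {x : Site 3 | 0 ≤ x 0} (Pi.single 1 1 : Site 3) y) ∧
                ω ∉ openConnIn {x : Site 3 | 0 ≤ x 0} 0 (Pi.single 1 1 : Site 3)} ≤
        (bondPercolation (zdGraph 3) (criticalProbI 3)).real
            {ω | s((0 : Site 3), (0 : Site 3) + Pi.single 1 1) ∈ ω ∧
              ω \ {s((0 : Site 3), (0 : Site 3) + Pi.single 1 1)} ∉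
                openConnIn {z : Site 3 | (0 : Site 3) 0 ≤ z 0} 0 ((0 : Site 3) + Pi.single 1 1) ∧
              (∃ u : Site 3, u - 0 ∈ box 3 r ∧
                ω \ {s((0 : Site 3), (0 : Site 3) + Pi.single 1 1)} ∈
                  openConnIn {z : Site 3 | (0 : Site 3) 0 ≤ z 0} 0 u ∧
                ∃ v w : Site 3, ω ∈ openConnIn {z : Site 3 | (0 : Site 3) 0 + 1 ≤ z 0} u v ∧
                  ω ∈ openConnIn {z : Site 3 | (0 : Site 3) 0 + 1 ≤ z 0} u w ∧
                  ∃ i : Fin 3, (h : ℤ) ≤ |v i - w i|) ∧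
              (∃ u : Site 3, u - ((0 : Site 3) + Pi.single 1 1) ∈ box 3 r ∧
                ω \ {s((0 : Site 3), (0 : Site 3) + Pi.single 1 1)} ∈
                  openConnIn {z : Site 3 | (0 : Site 3) 0 ≤ z 0} ((0 : Site 3) + Pi.single 1 1) u ∧
                ∃ v w : Site 3, ω ∈ openConnIn {z : Site 3 | (0 : Site 3) 0 + 1 ≤ z 0} u v ∧
                  ω ∈ openConnIn {z : Site 3 | (0 : Site 3) 0 + 1 ≤ z 0} u w ∧
                  ∃ i : Fin 3, (h : ℤ) ≤ |v i - w i|)} +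
        (bondPercolation (zdGraph 3) (criticalProbI 3)).real
            {ω | ∃ y : Site 3, (∃ i : Fin 3, (r : ℤ) ≤ |y i - (0 : Site 3) i|) ∧
              ω ∈ openConnIn {z : Site 3 | 0 ≤ z 0 ∧ z 0 ≤ h} 0 y} +
        (bondPercolation (zdGraph 3) (criticalProbI 3)).real
            {ω | ∃ y : Site 3, (∃ i : Fin 3, (r : ℤ) ≤ |y i - (Pi.single 1 1 : Site 3) i|) ∧
              ω ∈ openConnIn {z : Site 3 | 0 ≤ z 0 ∧ z 0 ≤ h} (Pi.single 1 1 : Site 3) y} := by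
  exact Summit.CriticalPhenomena.PercolationContinuityZ3.Theorems.BoundaryTwoArmDecay.stub_reduction

/-- STUB 2 (L) — CLOSED (landed p112209 + helpers p101288/p103954/p106177, `Theorems.BoundaryTwoArmDecay.stub_forest`, c = 1) — THE LEVER — the merge-forest inequality by translation over roots and LEVELS:
`c r³ P(LB♭(r,h) at 0) ≤ (M+1)·E[D(r,h)] + r³·P(N(r,h) > M)` for all `M`, `1 ≤ h ≤ r`. -/
theorem stub_forest :
    ∃ c : ℝ, 0 < c ∧ ∀ r h M : ℕ, 1 ≤ r → 1 ≤ h → h ≤ r →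
      c * (r : ℝ) ^ 3 *
          (bondPercolation (zdGraph 3) (criticalProbI 3)).real
            {ω | s((0 : Site 3), (0 : Site 3) + Pi.single 1 1) ∈ ω ∧
              ω \ {s((0 : Site 3), (0 : Site 3) + Pi.single 1 1)} ∉
                openConnIn {z : Site 3 | (0 : Site 3) 0 ≤ z 0} 0 ((0 : Site 3) + Pi.single 1 1) ∧
              (∃ u : Site 3, u - 0 ∈ box 3 r ∧
                ω \ {s((0 : Site 3), (0 : Site 3) + Pi.single 1 1)} ∈
                  openConnIn {z : Site 3 | (0 : Site 3) 0 ≤ z 0} 0 u ∧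
                ∃ v w : Site 3, ω ∈ openConnIn {z : Site 3 | (0 : Site 3) 0 + 1 ≤ z 0} u v ∧
                  ω ∈ openConnIn {z : Site 3 | (0 : Site 3) 0 + 1 ≤ z 0} u w ∧
                  ∃ i : Fin 3, (h : ℤ) ≤ |v i - w i|) ∧
              (∃ u : Site 3, u - ((0 : Site 3) + Pi.single 1 1) ∈ box 3 r ∧
                ω \ {s((0 : Site 3), (0 : Site 3) + Pi.single 1 1)} ∈
                  openConnIn {z : Site 3 | (0 : Site 3) 0 ≤ z 0} ((0 : Site 3) + Pi.single 1 1) u ∧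
                ∃ v w : Site 3, ω ∈ openConnIn {z : Site 3 | (0 : Site 3) 0 + 1 ≤ z 0} u v ∧
                  ω ∈ openConnIn {z : Site 3 | (0 : Site 3) 0 + 1 ≤ z 0} u w ∧
                  ∃ i : Fin 3, (h : ℤ) ≤ |v i - w i|)} ≤
        (M + 1 : ℝ) *
            (∫ ω, ((sSup {k : ℕ | ∃ S : Fin k → Finset (Site 3),
                (∀ a, (↑(S a) : Set (Site 3)) ⊆ {z : Site 3 | 0 ≤ z 0} ∩ ↑(box 3 (5 * r))) ∧
                (∀ a, ∀ u ∈ S a, ∀ v ∈ S a, ω ∈ openConnIn (↑(S a) : Set (Site 3)) u v) ∧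
                (∀ a, ∃ u ∈ S a, ∃ v ∈ S a, ∃ i : Fin 3, (h : ℤ) ≤ 2 * |u i - v i|) ∧
                (∀ a b, a ≠ b → Disjoint (S a) (S b))} : ℕ) : ℝ)
              ∂(bondPercolation (zdGraph 3) (criticalProbI 3))) +
          (r : ℝ) ^ 3 *
            (bondPercolation (zdGraph 3) (criticalProbI 3)).real
              {ω | M < sSup {m : ℕ | ∃ t : ℤ, ∃ u v : Site 3, ∃ x : Fin m → Site 3,
                Function.Injective x ∧ 0 ≤ t ∧ ∀ a, x a 0 = t ∧ x a ∈ box 3 r ∧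
                  ω ∈ {ω : BondConfig (Site 3) | s(x a, x a + Pi.single 1 1) ∈ ω ∧
                    ω \ {s(x a, x a + Pi.single 1 1)} ∉
                      openConnIn {z : Site 3 | x a 0 ≤ z 0} (x a) (x a + Pi.single 1 1) ∧
                    (∃ u : Site 3, u - x a ∈ box 3 r ∧
                      ω \ {s(x a, x a + Pi.single 1 1)} ∈ openConnIn {z : Site 3 | x a 0 ≤ z 0} (x a) u ∧
                      ∃ v w : Site 3, ω ∈ openConnIn {z : Site 3 | x a 0 + 1 ≤ z 0} u v ∧
                        ω ∈ openConnIn {z : Site 3 | x a 0 + 1 ≤ z 0} u w ∧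
                        ∃ i : Fin 3, (h : ℤ) ≤ |v i - w i|) ∧
                    (∃ u : Site 3, u - (x a + Pi.single 1 1) ∈ box 3 r ∧
                      ω \ {s(x a, x a + Pi.single 1 1)} ∈
                        openConnIn {z : Site 3 | x a 0 ≤ z 0} (x a + Pi.single 1 1) u ∧
                      ∃ v w : Site 3, ω ∈ openConnIn {z : Site 3 | x a 0 + 1 ≤ z 0} u v ∧
                        ω ∈ openConnIn {z : Site 3 | x a 0 + 1 ≤ z 0} u w ∧
                        ∃ i : Fin 3, (h : ℤ) ≤ |v i - w i|)} ∧
                  ω ∈ openConnIn {z : Site 3 | t ≤ z 0} u v ∧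
                  ω \ {s(x a, x a + Pi.single 1 1)} ∉ openConnIn {z : Site 3 | t ≤ z 0} u v}} := by
  exact Summit.CriticalPhenomena.PercolationContinuityZ3.Theorems.BoundaryTwoArmDecay.stub_forest

/-- STUB 3 (XL, OPEN, HARDEST) — SPARSE PIECES / VoidLB(1/4): the expected packing number of pairwise-disjoint
open connected pieces of diameter `≥ h/2` in the half-box `ℍ ∩ B_{5r}` is at most `C (r/h)³ h^{1/4}`. -/
theorem stub_sparse :
    ∃ C : ℝ, ∀ r h : ℕ, 1 ≤ h → h ≤ r →
      (∫ ω, ((sSup {k : ℕ | ∃ S : Fin k → Finset (Site 3),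
          (∀ a, (↑(S a) : Set (Site 3)) ⊆ {z : Site 3 | 0 ≤ z 0} ∩ ↑(box 3 (5 * r))) ∧
          (∀ a, ∀ u ∈ S a, ∀ v ∈ S a, ω ∈ openConnIn (↑(S a) : Set (Site 3)) u v) ∧
          (∀ a, ∃ u ∈ S a, ∃ v ∈ S a, ∃ i : Fin 3, (h : ℤ) ≤ 2 * |u i - v i|) ∧
          (∀ a b, a ≠ b → Disjoint (S a) (S b))} : ℕ) : ℝ)
        ∂(bondPercolation (zdGraph 3) (criticalProbI 3))) ≤
        C * ((r : ℝ) / h) ^ 3 * (h : ℝ) ^ (1 / 4 : ℝ) := by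
  sorry

/-- STUB 4 (L, OPEN) — NECKLACE TAIL: series chains of more than `r^{1/20}` ♭-bridges at one level inside one
`H_t`-cluster have probability `≤ C r^{-3}`. -/
theorem stub_necklace :
    ∃ C : ℝ, ∀ r h : ℕ, 1 ≤ h → h ≤ r →
      (bondPercolation (zdGraph 3) (criticalProbI 3)).real
          {ω | (r : ℝ) ^ (1 / 20 : ℝ) < ((sSup {m : ℕ | ∃ t : ℤ, ∃ u v : Site 3, ∃ x : Fin m → Site 3,
            Function.Injective x ∧ 0 ≤ t ∧ ∀ a, x a 0 = t ∧ x a ∈ box 3 r ∧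
              ω ∈ {ω : BondConfig (Site 3) | s(x a, x a + Pi.single 1 1) ∈ ω ∧
                ω \ {s(x a, x a + Pi.single 1 1)} ∉
                  openConnIn {z : Site 3 | x a 0 ≤ z 0} (x a) (x a + Pi.single 1 1) ∧
                (∃ u : Site 3, u - x a ∈ box 3 r ∧
                  ω \ {s(x a, x a + Pi.single 1 1)} ∈ openConnIn {z : Site 3 | x a 0 ≤ z 0} (x a) u ∧
                  ∃ v w : Site 3, ω ∈ openConnIn {z : Site 3 | x a 0 + 1 ≤ z 0} u v ∧
                    ω ∈ openConnIn {z : Site 3 | x a 0 + 1 ≤ z 0} u w ∧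
                    ∃ i : Fin 3, (h : ℤ) ≤ |v i - w i|) ∧
                (∃ u : Site 3, u - (x a + Pi.single 1 1) ∈ box 3 r ∧
                  ω \ {s(x a, x a + Pi.single 1 1)} ∈
                    openConnIn {z : Site 3 | x a 0 ≤ z 0} (x a + Pi.single 1 1) u ∧
                  ∃ v w : Site 3, ω ∈ openConnIn {z : Site 3 | x a 0 + 1 ≤ z 0} u v ∧
                    ω ∈ openConnIn {z : Site 3 | x a 0 + 1 ≤ z 0} u w ∧
                    ∃ i : Fin 3, (h : ℤ) ≤ |v i - w i|)} ∧
              ω ∈ openConnIn {z : Site 3 | t ≤ z 0} u v ∧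
              ω \ {s(x a, x a + Pi.single 1 1)} ∉ openConnIn {z : Site 3 | t ≤ z 0} u v} : ℕ) : ℝ)} ≤
        C * (r : ℝ) ^ (-3 : ℝ) := by
  sorry

/-- STUB 5 (XL, OPEN) — THIN-SLAB DECAY: for `h ≤ r^{19/20}`, a floor root is joined to sup-distance `r` inside the
slab `{0 ≤ z 0 ≤ h}` with probability `≤ C r^{-3}` (subcritical slab at `p_c(ℤ³)` with crossover `ξ_h ≲ h^{20/19-}`). -/
theorem stub_thinSlab :
    ∃ C : ℝ, ∀ r h : ℕ, 1 ≤ r → (h : ℝ) ≤ (r : ℝ) ^ (19 / 20 : ℝ) → ∀ x : Site 3, x 0 = 0 →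
      (bondPercolation (zdGraph 3) (criticalProbI 3)).real
          {ω | ∃ y : Site 3, (∃ i : Fin 3, (r : ℤ) ≤ |y i - x i|) ∧
            ω ∈ openConnIn {z : Site 3 | 0 ≤ z 0 ∧ z 0 ≤ h} x y} ≤ C * (r : ℝ) ^ (-3 : ℝ) := by
  sorry

/-! ### Consistency: each named statement IS its registered stub (definitionally) -/

theorem reduction_holds : Reduction := stub_reduction
theorem forest_holds : Forest := stub_forest
theorem sparse_holds : Sparse (1 / 4) := stub_sparse
theorem necklace_holds : Necklace (1 / 20) := stub_necklace
theorem thinSlab_holds : ThinSlab (19 / 20) := stub_thinSlab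

/-! ### Name-keyed aliases (hypotheses of the composition) -/
namespace Registered

/-- Alias of `Reduction` keyed by the registered stub name. -/
abbrev stub_reduction : Prop := Reduction
/-- Alias of `Forest` keyed by the registered stub name. -/
abbrev stub_forest : Prop := Forest
/-- Alias of `Sparse (1/4)` keyed by the registered stub name. -/
abbrev stub_sparse : Prop := Sparse (1 / 4)
/-- Alias of `Necklace (1/20)` keyed by the registered stub name. -/
abbrev stub_necklace : Prop := Necklace (1 / 20)
/-- Alias of `ThinSlab (19/20)` keyed by the registered stub name. -/
abbrev stub_thinSlab : Prop := ThinSlab (19 / 20)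

end Registered


/-! ### Glue (PROVED): the exponent bookkeeping `Reduction ∧ Forest ∧ Sparse σ ∧ Necklace ε ∧ ThinSlab θ ⇒ A` -/

section Glue

/-- `p_c(ℤ³) > 0` (Grimmett 1999 §1.4, in tree). -/
theorem criticalProbI_pos : 0 < (criticalProbI 3 : ℝ) := by
  rw [coe_criticalProbI]
  exact (Grimmett1999_criticalProb_pos_lt_one_holds 3 (by norm_num)).1

/-- The floor neighbour `e` lies on the floor. -/
theorem e_apply_zero : (e : Site 3) 0 = 0 := by
  simp [e]

/-- Pure exponent arithmetic: with `h ≥ r^θ/2 > 0`, `r ≥ 1`,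
`r^ε · h^{-3} · h^σ ≤ 2^{3-σ} · r^{ε + θ(σ-3)}`. -/
theorem scale_bound {σ ε θ : ℝ} (hσ : σ ≤ 3) {r h : ℝ} (hr : 0 < r) (hh : 0 < h)
    (h2 : r ^ θ ≤ 2 * h) :
    r ^ ε * (h ^ (3 : ℕ))⁻¹ * h ^ σ ≤ (2 : ℝ) ^ (3 - σ) * r ^ (ε + θ * (σ - 3)) := by
  have e1 : (h ^ (3 : ℕ))⁻¹ * h ^ σ = h ^ (σ - 3) := by
    rw [← Real.rpow_natCast h 3, ← Real.rpow_neg hh.le, ← Real.rpow_add hh]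
    congr 1; push_cast; ring
  have e2 : h ^ (σ - 3) ≤ (r ^ θ / 2) ^ (σ - 3) :=
    Real.rpow_le_rpow_of_nonpos (by positivity) (by linarith) (by linarith)
  have e3 : (r ^ θ / 2) ^ (σ - 3) = (2 : ℝ) ^ (3 - σ) * r ^ (θ * (σ - 3)) := by
    rw [Real.div_rpow (Real.rpow_nonneg hr.le _) (by norm_num), ← Real.rpow_mul hr.le,
      div_eq_mul_inv, ← Real.rpow_neg (by norm_num), neg_sub, mul_comm]
  calc r ^ ε * (h ^ (3 : ℕ))⁻¹ * h ^ σ = r ^ ε * h ^ (σ - 3) := by rw [mul_assoc, e1]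
    _ ≤ r ^ ε * (r ^ θ / 2) ^ (σ - 3) := mul_le_mul_of_nonneg_left e2 (Real.rpow_nonneg hr.le _)
    _ = (2 : ℝ) ^ (3 - σ) * (r ^ ε * r ^ (θ * (σ - 3))) := by rw [e3]; ring
    _ = (2 : ℝ) ^ (3 - σ) * r ^ (ε + θ * (σ - 3)) := by rw [← Real.rpow_add hr]

/-- **Exponent bookkeeping.** The five statements with per-box growth `σ`, necklace threshold `r^ε` and slab
exponent `θ` such that `κ := θ(3-σ) - ε - 5/2 ∈ (0, 1/2]` give the decay of the crux event with exponent `5/2 + κ`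
(choose `h = ⌊r^θ⌋₊`, `M = ⌈r^ε⌉₊`). -/
theorem decay_of_budget {σ ε θ : ℝ} (hθ0 : 0 < θ) (hθ1 : θ ≤ 1) (hε : 0 ≤ ε) (hσ : σ ≤ 3)
    (hκ : 5 / 2 < θ * (3 - σ) - ε) (hκ3 : θ * (3 - σ) - ε ≤ 3)
    (hR : Reduction) (hF : Forest) (hS : Sparse σ) (hN : Necklace ε) (hT : ThinSlab θ) :
    ∃ κ C : ℝ, 0 < κ ∧ ∀ r : ℕ, 1 ≤ r → μ.real (E r) ≤ C * (r : ℝ) ^ (-(5 / 2 + κ)) := by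
  obtain ⟨c, hc, hF⟩ := hF
  obtain ⟨CS, hS⟩ := hS
  obtain ⟨CN, hN⟩ := hN
  obtain ⟨CT, hT⟩ := hT
  have hp0 : 0 < (criticalProbI 3 : ℝ) := criticalProbI_pos
  -- the decay exponent and the constant
  refine ⟨θ * (3 - σ) - ε - 5 / 2,
    (3 * max CS 0 * (2 : ℝ) ^ (3 - σ) / c + max CN 0 / c + 2 * max CT 0) / (criticalProbI 3 : ℝ),
    by linarith, fun r hr => ?_⟩
  have hr1 : (1 : ℝ) ≤ r := by exact_mod_cast hr
  have hr0 : (0 : ℝ) < r := by linarith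
  -- the two scales `h = ⌊r^θ⌋₊`, `M = ⌈r^ε⌉₊`
  obtain ⟨h, hh⟩ : ∃ h : ℕ, h = ⌊(r : ℝ) ^ θ⌋₊ := ⟨_, rfl⟩
  obtain ⟨M, hM⟩ : ∃ M : ℕ, M = ⌈(r : ℝ) ^ ε⌉₊ := ⟨_, rfl⟩
  have ha1 : 1 ≤ (r : ℝ) ^ θ := Real.one_le_rpow hr1 hθ0.le
  have hh1 : 1 ≤ h := by rw [hh]; exact Nat.succ_le_of_lt (Nat.floor_pos.2 ha1)
  have hha : (h : ℝ) ≤ (r : ℝ) ^ θ := by rw [hh]; exact Nat.floor_le (by positivity)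
  have har : (r : ℝ) ^ θ ≤ r := by
    calc (r : ℝ) ^ θ ≤ (r : ℝ) ^ (1 : ℝ) := Real.rpow_le_rpow_of_exponent_le hr1 hθ1
      _ = r := Real.rpow_one _
  have hhr : h ≤ r := by exact_mod_cast hha.trans har
  have hhpos : (0 : ℝ) < h := by exact_mod_cast hh1
  have ha2h : (r : ℝ) ^ θ ≤ 2 * h := by
    have h1 : (r : ℝ) ^ θ < ⌊(r : ℝ) ^ θ⌋₊ + 1 := Nat.lt_floor_add_one _
    rw [← hh] at h1
    have h2 : (1 : ℝ) ≤ h := by exact_mod_cast hh1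
    linarith
  have hMge : (r : ℝ) ^ ε ≤ M := by rw [hM]; exact Nat.le_ceil _
  have hrε1 : 1 ≤ (r : ℝ) ^ ε := Real.one_le_rpow hr1 hε
  have hM3 : (M : ℝ) + 1 ≤ 3 * (r : ℝ) ^ ε := by
    have h1 : (⌈(r : ℝ) ^ ε⌉₊ : ℝ) < (r : ℝ) ^ ε + 1 := Nat.ceil_lt_add_one (by positivity)
    rw [← hM] at h1
    linarith
  -- the five inequalities at these scales
  have h1 := hR r h hr
  have h2 := hF r h M hr hh1 hhr
  have h3 := hS r h hh1 hhr
  have h4 := hN r h hh1 hhr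
  have h5 := hT r h hr hha 0 rfl
  have h6 := hT r h hr hha e e_apply_zero
  -- {M < N} ⊆ {r^ε < N}
  have h7 : μ.real {ω | M < Nchain r h ω} ≤ μ.real {ω | (r : ℝ) ^ ε < (Nchain r h ω : ℝ)} := by
    refine measureReal_mono (fun ω hω => ?_) (measure_ne_top _ _)
    have hω' : (M : ℝ) < (Nchain r h ω : ℝ) := by exact_mod_cast hω
    exact lt_of_le_of_lt hMge hω'
  -- nonnegative constants
  have hX0 : 0 ≤ ((r : ℝ) / h) ^ 3 * (h : ℝ) ^ σ := by positivity
  have hA0 : 0 ≤ (r : ℝ) ^ (-(5 / 2 + (θ * (3 - σ) - ε - 5 / 2))) := Real.rpow_nonneg hr0.le _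
  have hB0 : 0 ≤ (r : ℝ) ^ (-3 : ℝ) := Real.rpow_nonneg hr0.le _
  have hBA : (r : ℝ) ^ (-3 : ℝ) ≤ (r : ℝ) ^ (-(5 / 2 + (θ * (3 - σ) - ε - 5 / 2))) :=
    Real.rpow_le_rpow_of_exponent_le hr1 (by linarith)
  have h3' : ∫ ω, (Dpieces r h ω : ℝ) ∂μ ≤ max CS 0 * (((r : ℝ) / h) ^ 3 * (h : ℝ) ^ σ) :=
    calc ∫ ω, (Dpieces r h ω : ℝ) ∂μ ≤ CS * ((r : ℝ) / h) ^ 3 * (h : ℝ) ^ σ := h3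
      _ = CS * (((r : ℝ) / h) ^ 3 * (h : ℝ) ^ σ) := by ring
      _ ≤ max CS 0 * (((r : ℝ) / h) ^ 3 * (h : ℝ) ^ σ) :=
          mul_le_mul_of_nonneg_right (le_max_left _ _) hX0
  have h4' : μ.real {ω | M < Nchain r h ω} ≤ max CN 0 * (r : ℝ) ^ (-3 : ℝ) :=
    h7.trans (h4.trans (mul_le_mul_of_nonneg_right (le_max_left _ _) hB0))
  have h5' : μ.real (ThinFloor r h 0) ≤ max CT 0 * (r : ℝ) ^ (-3 : ℝ) :=
    h5.trans (mul_le_mul_of_nonneg_right (le_max_left _ _) hB0)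
  have h6' : μ.real (ThinFloor r h e) ≤ max CT 0 * (r : ℝ) ^ (-3 : ℝ) :=
    h6.trans (mul_le_mul_of_nonneg_right (le_max_left _ _) hB0)
  -- the key scale estimate: r^ε h^{-3} h^σ ≤ 2^{3-σ} r^{-(5/2+κ)}
  have hpow : (r : ℝ) ^ ε * ((h : ℝ) ^ (3 : ℕ))⁻¹ * (h : ℝ) ^ σ ≤
      (2 : ℝ) ^ (3 - σ) * (r : ℝ) ^ (-(5 / 2 + (θ * (3 - σ) - ε - 5 / 2))) := by
    have := scale_bound (ε := ε) hσ hr0 hhpos ha2h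
    have hexp : ε + θ * (σ - 3) = -(5 / 2 + (θ * (3 - σ) - ε - 5 / 2)) := by ring
    rwa [hexp] at this
  -- the forest bound, made explicit: c·P(LB♭) ≤ 3·CS'·(r^ε h^{-3} h^σ) + CN'·r^{-3}
  have hLB : c * μ.real (LBflatAt r h 0) ≤
      3 * max CS 0 * ((r : ℝ) ^ ε * ((h : ℝ) ^ (3 : ℕ))⁻¹ * (h : ℝ) ^ σ) + max CN 0 * (r : ℝ) ^ (-3 : ℝ) := by
    have hr3 : (0 : ℝ) < (r : ℝ) ^ 3 := by positivity
    have hM1 : (0 : ℝ) ≤ (M : ℝ) + 1 := by positivity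
    have step : c * (r : ℝ) ^ 3 * μ.real (LBflatAt r h 0) ≤
        (3 * (r : ℝ) ^ ε) * (max CS 0 * (((r : ℝ) / h) ^ 3 * (h : ℝ) ^ σ)) +
          (r : ℝ) ^ 3 * (max CN 0 * (r : ℝ) ^ (-3 : ℝ)) :=
      calc c * (r : ℝ) ^ 3 * μ.real (LBflatAt r h 0)
          ≤ ((M : ℝ) + 1) * (∫ ω, (Dpieces r h ω : ℝ) ∂μ) + (r : ℝ) ^ 3 * μ.real {ω | M < Nchain r h ω} := h2
        _ ≤ ((M : ℝ) + 1) * (max CS 0 * (((r : ℝ) / h) ^ 3 * (h : ℝ) ^ σ)) +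
              (r : ℝ) ^ 3 * (max CN 0 * (r : ℝ) ^ (-3 : ℝ)) :=
            add_le_add (mul_le_mul_of_nonneg_left h3' hM1) (mul_le_mul_of_nonneg_left h4' hr3.le)
        _ ≤ (3 * (r : ℝ) ^ ε) * (max CS 0 * (((r : ℝ) / h) ^ 3 * (h : ℝ) ^ σ)) +
              (r : ℝ) ^ 3 * (max CN 0 * (r : ℝ) ^ (-3 : ℝ)) := by
            gcongr
    have hid : (3 * (r : ℝ) ^ ε) * (max CS 0 * (((r : ℝ) / h) ^ 3 * (h : ℝ) ^ σ)) +
          (r : ℝ) ^ 3 * (max CN 0 * (r : ℝ) ^ (-3 : ℝ)) =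
        (r : ℝ) ^ 3 * (3 * max CS 0 * ((r : ℝ) ^ ε * ((h : ℝ) ^ (3 : ℕ))⁻¹ * (h : ℝ) ^ σ) +
          max CN 0 * (r : ℝ) ^ (-3 : ℝ)) := by
      rw [div_pow]
      field_simp
    rw [hid] at step
    have step' : (r : ℝ) ^ 3 * (c * μ.real (LBflatAt r h 0)) ≤
        (r : ℝ) ^ 3 * (3 * max CS 0 * ((r : ℝ) ^ ε * ((h : ℝ) ^ (3 : ℕ))⁻¹ * (h : ℝ) ^ σ) +
          max CN 0 * (r : ℝ) ^ (-3 : ℝ)) := by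
      calc (r : ℝ) ^ 3 * (c * μ.real (LBflatAt r h 0)) = c * (r : ℝ) ^ 3 * μ.real (LBflatAt r h 0) := by ring
        _ ≤ _ := step
    exact le_of_mul_le_mul_left step' hr3
  -- hence c·P(LB♭) ≤ (3 CS' 2^{3-σ} + CN')·r^{-(5/2+κ)}
  have hLB' : c * μ.real (LBflatAt r h 0) ≤
      (3 * max CS 0 * (2 : ℝ) ^ (3 - σ) + max CN 0) * (r : ℝ) ^ (-(5 / 2 + (θ * (3 - σ) - ε - 5 / 2))) := by
    have hCS0 : 0 ≤ 3 * max CS 0 := by positivity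
    have hCN0 : 0 ≤ max CN 0 := le_max_right _ _
    calc c * μ.real (LBflatAt r h 0)
        ≤ 3 * max CS 0 * ((r : ℝ) ^ ε * ((h : ℝ) ^ (3 : ℕ))⁻¹ * (h : ℝ) ^ σ) + max CN 0 * (r : ℝ) ^ (-3 : ℝ) := hLB
      _ ≤ 3 * max CS 0 * ((2 : ℝ) ^ (3 - σ) * (r : ℝ) ^ (-(5 / 2 + (θ * (3 - σ) - ε - 5 / 2)))) +
            max CN 0 * (r : ℝ) ^ (-(5 / 2 + (θ * (3 - σ) - ε - 5 / 2))) :=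
          add_le_add (mul_le_mul_of_nonneg_left hpow hCS0) (mul_le_mul_of_nonneg_left hBA hCN0)
      _ = _ := by ring
  -- assemble: p_c·P(E) ≤ P(LB♭) + P(Thin 0) + P(Thin e)
  have hsum : (criticalProbI 3 : ℝ) * μ.real (E r) ≤
      (3 * max CS 0 * (2 : ℝ) ^ (3 - σ) / c + max CN 0 / c + 2 * max CT 0) *
        (r : ℝ) ^ (-(5 / 2 + (θ * (3 - σ) - ε - 5 / 2))) := by
    have hLB'' : μ.real (LBflatAt r h 0) ≤
        (3 * max CS 0 * (2 : ℝ) ^ (3 - σ) + max CN 0) / c * (r : ℝ) ^ (-(5 / 2 + (θ * (3 - σ) - ε - 5 / 2))) := by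
      rw [div_mul_eq_mul_div, le_div_iff₀ hc, mul_comm]
      exact hLB'
    have hCT0 : 0 ≤ max CT 0 := le_max_right _ _
    calc (criticalProbI 3 : ℝ) * μ.real (E r)
        ≤ μ.real (LBflatAt r h 0) + μ.real (ThinFloor r h 0) + μ.real (ThinFloor r h e) := h1
      _ ≤ (3 * max CS 0 * (2 : ℝ) ^ (3 - σ) + max CN 0) / c * (r : ℝ) ^ (-(5 / 2 + (θ * (3 - σ) - ε - 5 / 2))) +
            max CT 0 * (r : ℝ) ^ (-(5 / 2 + (θ * (3 - σ) - ε - 5 / 2))) +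
            max CT 0 * (r : ℝ) ^ (-(5 / 2 + (θ * (3 - σ) - ε - 5 / 2))) :=
          add_le_add (add_le_add hLB'' (h5'.trans (mul_le_mul_of_nonneg_left hBA hCT0)))
            (h6'.trans (mul_le_mul_of_nonneg_left hBA hCT0))
      _ = _ := by ring
  -- divide by p_c
  rw [div_mul_eq_mul_div, le_div_iff₀ hp0, mul_comm]
  exact hsum

end Glue

/-! ### The composition: the five stubs imply the crux, by name -/

/-- **`BoundaryTwoArmDecay` from the five stubs** (no `sorry` outside the stubs):
`κ = (19/20)(3 - 1/4) - 1/20 - 5/2 = 1/16`. -/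
theorem BoundaryTwoArmDecay_of (h₁ : Registered.stub_reduction) (h₂ : Registered.stub_forest)
    (h₃ : Registered.stub_sparse) (h₄ : Registered.stub_necklace) (h₅ : Registered.stub_thinSlab) :
    BoundaryTwoArmDecay :=
  boundaryTwoArmDecay_iff.mpr
    (decay_of_budget (σ := 1 / 4) (ε := 1 / 20) (θ := 19 / 20) (by norm_num) (by norm_num) (by norm_num)
      (by norm_num) (by norm_num) (by norm_num) h₁ h₂ h₃ h₄ h₅)

/-- Wiring check: the registered stubs feed `BoundaryTwoArmDecay_of` as stated. -/
theorem BoundaryTwoArmDecay_proof : BoundaryTwoArmDecay :=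
  BoundaryTwoArmDecay_of stub_reduction stub_forest stub_sparse stub_necklace stub_thinSlab

end Summit.CriticalPhenomena.PercolationContinuityZ3.Cruxes.BoundaryTwoArmDecay.MergeForestLevelBridges

end
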